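import Summits.Ventures.PercRepro2.CaseOneClosedAtIff

/-!
# The open core of the rung
(blind cell PercRepro2, p1 g22; `closedAt_of_residual` and `closedAt_of_moves_closedAnchor` combined)

`InCore o a₁ a₂ b v E ends` says that `(E, ends)` is residual for `v` and that `(E, ends, v)` is NOT
reachable by moves from any closed anchor (a mark, a marked star, a uwob gadget, a roots-only or a
roots-and-`o` vertex). **`closedAt_of_core`**: if the statement vertex has the four forms for every weight
vector on every core instance, it has them on every finite graph — every graph is a thickening of a
residual graph (`closedAt_of_residual`), and a residual graph that is reachable by moves from a closed
anchor is closed already (`closedAt_of_moves_closedAnchor`). The core is exactly what the class table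
of S5 has not closed; S5's gap §2.3 lives there. Own code; standard axioms. -/

namespace Summit.Ventures.PercRepro2

namespace CaseOne

universe u

section Core
variable {V : Type*} [Fintype V] [DecidableEq V] (o a₁ a₂ b v : V)

/-- **The core**: residual for `v`, and not reachable by moves from a closed anchor. -/
def InCore (E : Type u) [Fintype E] [DecidableEq E] (ends : E → Sym2 V) : Prop :=
  Residual o a₁ a₂ b v E ends ∧
    ¬ ∃ (E₀ : Type u) (_ : Fintype E₀) (_ : DecidableEq E₀) (ends₀ : E₀ → Sym2 V) (v₀ : V),
      ClosedAnchor o a₁ a₂ b E₀ ends₀ v₀ ∧ Moves o a₁ a₂ b E₀ ends₀ v₀ E ends v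

variable {R : Type*} [Field R] [LinearOrder R] [IsStrictOrderedRing R]

/-- **The reduction to the core**: the four forms for every weight vector on every core instance give
them on every finite graph. -/
theorem closedAt_of_core
    (hcore : ∀ (E' : Type u) [Fintype E'] [DecidableEq E'] (ends' : E' → Sym2 V),
      InCore o a₁ a₂ b v E' ends' → ClosedAt R o a₁ a₂ b E' ends' v)
    (E : Type u) [Fintype E] [DecidableEq E] (ends : E → Sym2 V) : ClosedAt R o a₁ a₂ b E ends v := by
  refine closedAt_of_residual (fun E' _ _ ends' hres => ?_) E ends
  by_cases hreach : ∃ (E₀ : Type u) (_ : Fintype E₀) (_ : DecidableEq E₀) (ends₀ : E₀ → Sym2 V)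
      (v₀ : V), ClosedAnchor o a₁ a₂ b E₀ ends₀ v₀ ∧ Moves o a₁ a₂ b E₀ ends₀ v₀ E' ends' v
  · obtain ⟨E₀, _, _, ends₀, v₀, hanc, hmv⟩ := hreach
    exact closedAt_of_moves_closedAnchor o a₁ a₂ b hanc hmv
  · exact hcore E' ends' ⟨hres, hreach⟩

/-- The four forms for one weight vector on any finite graph, from the core. -/
theorem fourForms_of_core
    (hcore : ∀ (E' : Type u) [Fintype E'] [DecidableEq E'] (ends' : E' → Sym2 V),
      InCore o a₁ a₂ b v E' ends' → ClosedAt R o a₁ a₂ b E' ends' v)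
    {E : Type u} [Fintype E] [DecidableEq E] (ends : E → Sym2 V) (p : E → R) (hp : IsProbVec p) :
    FourForms p ends o a₁ a₂ v b :=
  closedAt_of_core o a₁ a₂ b v hcore E ends p hp

end Core

end CaseOne

end Summit.Ventures.PercRepro2
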